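/- Width seat 2/3 `ym-line-cbag-p1-w2` (prover-ym-line-cbag-p1-w2-g20-0) of the cell of ideator ym-idea-2, LINE 8
(route `EguchiKawaiDirectionLadder`), post-closure glue for the barrier entry `EguchiKawaiBreakdown`: at STRONG coupling
EVERY Wilson word of the Eguchi–Kawai single-site model concentrates at rate `O(1/N²)` (large-`N` factorisation) and EVERY
OPEN word vanishes as `N → ∞` — the full open-contour hypothesis (14.51) of the reduction, not only the elementary lines.
Route-independent; YM mass gap NOT touched (barrier-ledger line). -/
import Summits.QuantumFields.YangMills.Theorems.EguchiKawaiDirectionLadderWilsonWordDefs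
import Summits.QuantumFields.YangMills.Theorems.EguchiKawaiDirectionLadderReducedActionHessian
import Summits.Ventures.YMGap.Thresholds.LatticeBakryEmeryPoincare
import HarnessLib

/-!
# Wilson words of the Eguchi–Kawai model at strong coupling: concentration and vanishing of open words

Let `w = e^{−N² b S_R}` be the Eguchi–Kawai weight on `SU(N)^d` (product Haar `∏ dV_μ`), `16(d−1)|b| < 1`, and let
`W_l = (1/N) tr V_{μ₁}^{ε₁} ⋯ V_{μ_k}^{ε_k}` be the word of a letter list `l` (`ekWord l`).  With the multiplicities
`m_μ = wordMult l μ` and `M(l) = Σ_μ m_μ²` (`≤ k²`):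

* `linkLipschitz_ekWordRe/Im` : `Re W_l`, `Im W_l` are `m_μ/√N`-Lipschitz in the link `μ` (telescoping the product of unitaries,
  `‖tr A‖ ≤ √N ‖A‖_F`);
* `ek_poincare_wordRe/Im` (**large-`N` factorisation at strong coupling**): `(N/2 − 8(d−1)N|b|) ∫ w (Re W_l − ⟨Re W_l⟩)² ≤ (M(l)/N) ∫ w`
  — the variance of EVERY word (closed or open) is `≤ M(l)/(N²(1/2 − 8(d−1)|b|))`, by the kernel-checked multi-link Bakry–Émery
  Poincaré inequality `Summit.Ventures.YMGap.LatticeBakryEmery.poincare_gibbs_lipschitz` with the Hessian bound `hessBound_ekPot`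
  of `EguchiKawaiDirectionLadderReducedActionHessian.lean`;
* `integral_ekWord_mul_ekWeight_SU` (**exact `ℤ_N` symmetry**): if the winding `q_μ(l)` is not divisible by `N` then
  `∫ w W_l = 0` (rotate `V_μ ↦ ω_N V_μ`: the word picks up `ω_N^{q_μ} ≠ 1`, `ekWord_centerRotateSU`);
* `ekExpectationSU_normSq_ekWord_le` : hence `⟨|W_l|²⟩_{SU(N)} ≤ 2 M(l) / (N (N/2 − 8(d−1)N|b|))` for such words, and
  `ekExpectation_normSq_ekWord_le` — the same for the `U(N)` model (phase invariance of `|W_l|²`, w4's transfer);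
* `ekOpenWordsVanish_of_strongCoupling` : **for every `d`, every `b` with `16(d−1)|b| < 1` and every word with a non-zero
  winding in some direction, `⟨|W_l|²⟩_EK → 0` as `N → ∞`** — (14.51) `W_EK(C_xy) = 0` (`x ≠ y`) at strong coupling, the
  standing hypothesis of the Eguchi–Kawai reduction for ALL open contours; the elementary case `l = [(μ,+)]` is the component
  `μ` of `EKOpenLinesVanish d b` (`ekWord_single`).

HONEST FRAMING.  A theorem about the single-site integral at STRONG coupling (the proved breakdown `EguchiKawaiBreakdown_holds`
is at WEAK coupling; the window between is open).  It does not construct the `N = ∞` reduction, says nothing about the loop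
equations, and proves or advances nothing about the Yang–Mills mass gap / the summit `YangMills`.

References: Y. Makeenko, *Methods of Contemporary Gauge Theory* (2023) §14.3 (14.41)–(14.51), p. 246 «no such breaking occurs
within the strong-coupling expansion»; D. Bakry, M. Émery (1985); H. Shen, R. Zhu, X. Zhu, CMP 400 (2023) §4 (the lattice
analogue, incl. large-`N` factorisation Cor. 1.8).
-/

set_option autoImplicit false

noncomputable section

open scoped Matrix ComplexConjugate BigOperators Matrix.Norms.Frobenius ContDiff Topology
open Matrix Complex Finset MeasureTheory Filter
open Summit.Ventures.YMGap.LatticeBakryEmery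
open Literature.MathematicalPhysics.QuantumFieldTheory (frobNorm frobNorm_nonneg frobNorm_add_le frobNorm_zero
  frobNorm_conjTranspose frobNorm_unitary_mul frobNorm_mul_unitary suFrobDist haarProbability)
open Literature.MathematicalPhysics.QuantumFieldTheory.SUNBakryEmery (contDiff_reTrMul)
open Literature.Barriers.QuantumFields (UN EKConfig EKConfigSU ekHaar ekHaarSU inclSU ekWeight ekExpectation
  ekExpectationSU openLine coe_inclSU_apply IsPhaseInvariant centerRoot norm_centerRoot centerRotateSU centerGenSU
  integral_comp_leftMulLinkSU ekWeight_centerRotateSU continuous_ekWeight continuous_inclSU isProbabilityMeasure_ekHaarSU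
  ekPartitionSU_pos ekExpectation_eq_ekExpectationSU)

namespace Summit.QuantumFields.YangMills.Theorems.EguchiKawaiDirectionLadder

variable {d N : ℕ}

/-! ## Smoothness of the ambient words -/

/-- The ambient word matrix is a smooth function of the configuration (a product of links and adjoints of links). -/
theorem contDiff_ekWordMat (l : List (Fin d × Bool)) : ContDiff ℝ ∞ fun Q : Cfg (Fin d) N => ekWordMat l Q := by
  have hct : ContDiff ℝ ∞ fun X : Matrix (Fin N) (Fin N) ℂ => Xᴴ := by
    have hlin : IsBoundedLinearMap ℝ fun X : Matrix (Fin N) (Fin N) ℂ => Xᴴ := by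
      refine ⟨⟨fun X Y => conjTranspose_add X Y, fun r X => ?_⟩, 1, one_pos, fun X => ?_⟩
      · ext i j
        simp [conjTranspose_apply, Matrix.smul_apply]
      · rw [one_mul]
        exact (Matrix.frobenius_norm_conjTranspose X).le
    exact hlin.contDiff
  have hproj : ∀ e : Fin d, ContDiff ℝ ∞ fun Q : Cfg (Fin d) N => Q e := fun e =>
    (ContinuousLinearMap.proj (R := ℝ) (φ := fun _ : Fin d => Matrix (Fin N) (Fin N) ℂ) e).contDiff
  induction l with
  | nil => simp only [ekWordMat_nil]; exact contDiff_const
  | cons a l ih =>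
      simp only [ekWordMat_cons]
      refine ContDiff.mul ?_ ih
      unfold ekLetterMat
      split_ifs
      · exact hproj a.1
      · exact hct.comp (hproj a.1)

/-- `Re W_l / N` is smooth on the ambient algebra. -/
theorem contDiff_ekWordRe (l : List (Fin d × Bool)) : ContDiff ℝ ∞ (ekWordRe (N := N) l) := by
  have h1 : ContDiff ℝ ∞ fun X : Matrix (Fin N) (Fin N) ℂ => X.trace.re := by
    have := contDiff_reTrMul (N := N) 1
    simp only [Matrix.mul_one] at this
    exact this
  exact (h1.comp (contDiff_ekWordMat l)).div_const _

/-- `Im W_l / N` is smooth on the ambient algebra (`Im tr X = Re tr(X · (−i))`). -/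
theorem contDiff_ekWordIm (l : List (Fin d × Bool)) : ContDiff ℝ ∞ (ekWordIm (N := N) l) := by
  have h1 : ContDiff ℝ ∞ fun X : Matrix (Fin N) (Fin N) ℂ => X.trace.im := by
    have := contDiff_reTrMul (N := N) ((-I) • (1 : Matrix (Fin N) (Fin N) ℂ))
    have e : (fun X : Matrix (Fin N) (Fin N) ℂ => (X * ((-I) • (1 : Matrix (Fin N) (Fin N) ℂ))).trace.re) =
        fun X => X.trace.im := by
      funext X
      simp [Matrix.trace_smul, Complex.mul_re]
    rwa [e] at this
  exact (h1.comp (contDiff_ekWordMat l)).div_const _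

/-! ## Per-link Lipschitz bounds -/

/-- **Telescoping the product of unitaries**: if two `SU(N)^d` configurations differ only in the link `μ`, their word
matrices differ in Frobenius norm by at most `m_μ ‖g_μ − h_μ‖_F` (`m_μ` the multiplicity of `μ` in the word). -/
theorem frobNorm_ekWordMatrix_sub_le (l : List (Fin d × Bool)) (μ : Fin d) {g h : PSU (Fin d) N}
    (hgh : ∀ e', e' ≠ μ → g e' = h e') :
    frobNorm (ekWordMatrix l (inclSU g) - ekWordMatrix l (inclSU h)) ≤ wordMult l μ * suFrobDist (g μ) (h μ) := by
  induction l with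
  | nil => simp [frobNorm_zero, wordMult]
  | cons a l ih =>
      rw [ekWordMatrix_cons, ekWordMatrix_cons]
      set A := ekLetterMatrix (inclSU g) a
      set B := ekLetterMatrix (inclSU h) a
      set W := ekWordMatrix l (inclSU g)
      set W' := ekWordMatrix l (inclSU h)
      have hsplit : A * W - B * W' = (A - B) * W + B * (W - W') := by
        simp only [Matrix.sub_mul, Matrix.mul_sub]; abel
      have hW : W ∈ Matrix.unitaryGroup (Fin N) ℂ := ekWordMatrix_mem_unitaryGroup l _
      have hB : B ∈ Matrix.unitaryGroup (Fin N) ℂ := ekLetterMatrix_mem_unitaryGroup _ a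
      -- the letter difference
      have hAB : frobNorm (A - B) ≤ (if a.1 = μ then 1 else 0) * suFrobDist (g μ) (h μ) := by
        by_cases ha : a.1 = μ
        · rw [if_pos ha, one_mul]
          have e1 : frobNorm (A - B) = suFrobDist (g a.1) (h a.1) := by
            simp only [A, B, ekLetterMatrix, coe_inclSU_apply, suFrobDist]
            split_ifs
            · rfl
            · rw [← conjTranspose_sub, frobNorm_conjTranspose]
          rw [e1, ha]
        · rw [if_neg ha, zero_mul]
          have e1 : A = B := by
            simp only [A, B, ekLetterMatrix, coe_inclSU_apply, hgh a.1 ha]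
          rw [e1, sub_self, frobNorm_zero]
      have hcountN : wordMult (a :: l) μ = wordMult l μ + (if a.1 = μ then 1 else 0) := by
        by_cases ha : a.1 = μ <;> simp [wordMult, ha]
      have hcount : (wordMult (a :: l) μ : ℝ) = (if a.1 = μ then 1 else 0) + wordMult l μ := by
        rw [hcountN]
        split_ifs <;> push_cast <;> ring
      calc frobNorm (A * W - B * W') = frobNorm ((A - B) * W + B * (W - W')) := by rw [hsplit]
        _ ≤ frobNorm ((A - B) * W) + frobNorm (B * (W - W')) := frobNorm_add_le _ _
        _ = frobNorm (A - B) + frobNorm (W - W') := by rw [frobNorm_mul_unitary _ hW, frobNorm_unitary_mul hB]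
        _ ≤ (if a.1 = μ then 1 else 0) * suFrobDist (g μ) (h μ) + wordMult l μ * suFrobDist (g μ) (h μ) :=
            add_le_add hAB ih
        _ = wordMult (a :: l) μ * suFrobDist (g μ) (h μ) := by rw [hcount]; ring

/-- **`Re W_l` is `m_μ/√N`-Lipschitz in the link `μ`.** -/
theorem linkLipschitz_ekWordRe (l : List (Fin d × Bool)) :
    LinkLipschitz (ekWordRe (N := N) l) (fun μ => (wordMult l μ : ℝ) / Real.sqrt N) := by
  intro μ g h hgh
  rw [ekWordRe, ekWordRe, ekWordMat_emb, ekWordMat_emb]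
  have h1 := abs_div_sub_div_le (N := N) (x := (ekWordMatrix l (inclSU g)).trace.re)
    (y := (ekWordMatrix l (inclSU h)).trace.re) (A := ekWordMatrix l (inclSU g)) (B := ekWordMatrix l (inclSU h))
    (by rw [← Complex.sub_re, ← Matrix.trace_sub]; exact Complex.abs_re_le_norm _)
  refine h1.trans ?_
  have h2 := frobNorm_ekWordMatrix_sub_le l μ hgh
  calc 1 / Real.sqrt N * frobNorm (ekWordMatrix l (inclSU g) - ekWordMatrix l (inclSU h))
      ≤ 1 / Real.sqrt N * (wordMult l μ * suFrobDist (g μ) (h μ)) := mul_le_mul_of_nonneg_left h2 (by positivity)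
    _ = wordMult l μ / Real.sqrt N * suFrobDist (g μ) (h μ) := by ring

/-- **`Im W_l` is `m_μ/√N`-Lipschitz in the link `μ`.** -/
theorem linkLipschitz_ekWordIm (l : List (Fin d × Bool)) :
    LinkLipschitz (ekWordIm (N := N) l) (fun μ => (wordMult l μ : ℝ) / Real.sqrt N) := by
  intro μ g h hgh
  rw [ekWordIm, ekWordIm, ekWordMat_emb, ekWordMat_emb]
  have h1 := abs_div_sub_div_le (N := N) (x := (ekWordMatrix l (inclSU g)).trace.im)
    (y := (ekWordMatrix l (inclSU h)).trace.im) (A := ekWordMatrix l (inclSU g)) (B := ekWordMatrix l (inclSU h))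
    (by rw [← Complex.sub_im, ← Matrix.trace_sub]; exact Complex.abs_im_le_norm _)
  refine h1.trans ?_
  have h2 := frobNorm_ekWordMatrix_sub_le l μ hgh
  calc 1 / Real.sqrt N * frobNorm (ekWordMatrix l (inclSU g) - ekWordMatrix l (inclSU h))
      ≤ 1 / Real.sqrt N * (wordMult l μ * suFrobDist (g μ) (h μ)) := mul_le_mul_of_nonneg_left h2 (by positivity)
    _ = wordMult l μ / Real.sqrt N * suFrobDist (g μ) (h μ) := by ring

/-- `Σ_μ (m_μ/√N)² = (Σ_μ m_μ²)/N`. -/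
theorem sum_sq_wordLip (l : List (Fin d × Bool)) :
    ∑ μ : Fin d, ((wordMult l μ : ℝ) / Real.sqrt N) ^ 2 = (∑ μ : Fin d, (wordMult l μ : ℝ) ^ 2) / N := by
  rw [Finset.sum_div]
  refine Finset.sum_congr rfl fun μ _ => ?_
  rw [div_pow, Real.sq_sqrt (Nat.cast_nonneg N)]

/-! ## Large-`N` factorisation of every word at strong coupling -/

/-- **Large-`N` factorisation at strong coupling, real part**: for every `d`, `N ≥ 1`, `b` with `16(d−1)|b| < 1` and every
word `W_l`: `(N/2 − 8(d−1)N|b|) ∫ w (Re W_l − ⟨Re W_l⟩)² ≤ ((Σ_μ m_μ²)/N) ∫ w` over `∏ dV_μ` on `SU(N)^d`, `w = e^{−N² b S_R}` —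
the variance of every Wilson word of the single-site model is `O(M(l)/N²)` (multi-link Bakry–Émery). -/
theorem ek_poincare_wordRe (hN : N ≠ 0) {b : ℝ} (hb : 16 * ((d : ℝ) - 1) * |b| < 1) (l : List (Fin d × Bool)) :
    ((N : ℝ) / 2 - 8 * ((d : ℝ) - 1) * N * |b|) *
        ∫ V : EKConfigSU d N, ekWeight N b (inclSU V) * ((ekWord l (inclSU V)).re -
          (∫ V : EKConfigSU d N, ekWeight N b (inclSU V) * (ekWord l (inclSU V)).re ∂(ekHaarSU d N)) /
            (∫ V : EKConfigSU d N, ekWeight N b (inclSU V) ∂(ekHaarSU d N))) ^ 2 ∂(ekHaarSU d N) ≤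
      ((∑ μ : Fin d, (wordMult l μ : ℝ) ^ 2) / N) * ∫ V : EKConfigSU d N, ekWeight N b (inclSU V) ∂(ekHaarSU d N) := by
  have h := poincare_gibbs_lipschitz hN (ekPot_mem_polySpace b) (hessBound_ekPot hN b) (ekCurvature_pos hN hb)
    (contDiff_ekWordRe l) (L := fun μ => (wordMult l μ : ℝ) / Real.sqrt N)
    (fun μ => by positivity) (linkLipschitz_ekWordRe l)
  simp only [exp_ekPot_emb, ekWordRe_emb, sum_sq_wordLip l, haarPi_eq_ekHaarSU] at h
  exact h

/-- **Large-`N` factorisation at strong coupling, imaginary part** (as `ek_poincare_wordRe`). -/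
theorem ek_poincare_wordIm (hN : N ≠ 0) {b : ℝ} (hb : 16 * ((d : ℝ) - 1) * |b| < 1) (l : List (Fin d × Bool)) :
    ((N : ℝ) / 2 - 8 * ((d : ℝ) - 1) * N * |b|) *
        ∫ V : EKConfigSU d N, ekWeight N b (inclSU V) * ((ekWord l (inclSU V)).im -
          (∫ V : EKConfigSU d N, ekWeight N b (inclSU V) * (ekWord l (inclSU V)).im ∂(ekHaarSU d N)) /
            (∫ V : EKConfigSU d N, ekWeight N b (inclSU V) ∂(ekHaarSU d N))) ^ 2 ∂(ekHaarSU d N) ≤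
      ((∑ μ : Fin d, (wordMult l μ : ℝ) ^ 2) / N) * ∫ V : EKConfigSU d N, ekWeight N b (inclSU V) ∂(ekHaarSU d N) := by
  have h := poincare_gibbs_lipschitz hN (ekPot_mem_polySpace b) (hessBound_ekPot hN b) (ekCurvature_pos hN hb)
    (contDiff_ekWordIm l) (L := fun μ => (wordMult l μ : ℝ) / Real.sqrt N)
    (fun μ => by positivity) (linkLipschitz_ekWordIm l)
  simp only [exp_ekPot_emb, ekWordIm_emb, sum_sq_wordLip l, haarPi_eq_ekHaarSU] at h
  exact h

/-! ## Exact `ℤ_N` symmetry: open words have mean zero at every finite `N` not dividing the winding -/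

/-- The centre phase of a word with winding not divisible by `N` is not `1`: `ω_N^{n₊} ω̄_N^{n₋} ≠ 1`. -/
theorem centerPhase_ne_one (hN : N ≠ 0) {l : List (Fin d × Bool)} {μ : Fin d} (hq : ¬ ((N : ℤ) ∣ wordCharge l μ)) :
    centerRoot N ^ wordPlus l μ * conj (centerRoot N) ^ wordMinus l μ ≠ 1 := by
  have hprim : IsPrimitiveRoot (centerRoot N) N := Complex.isPrimitiveRoot_exp N hN
  have hne : centerRoot N ≠ 0 := fun h => by simpa [h] using norm_centerRoot N
  have hconj : conj (centerRoot N) = (centerRoot N)⁻¹ := (Complex.inv_eq_conj (norm_centerRoot N)).symm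
  intro h
  apply hq
  rw [← hprim.zpow_eq_one_iff_dvd, wordCharge, zpow_sub₀ hne, zpow_natCast, zpow_natCast, div_eq_mul_inv, ← inv_pow,
    ← hconj]
  exact h

/-- The word times the weight is integrable on `SU(N)^d` (continuous on a compact space). -/
theorem integrable_ekWord_mul_ekWeight_SU (b : ℝ) (l : List (Fin d × Bool)) :
    Integrable (fun V : EKConfigSU d N => ekWord l (inclSU V) * (ekWeight N b (inclSU V) : ℂ)) (ekHaarSU d N) := by
  haveI : IsProbabilityMeasure (ekHaarSU d N) := isProbabilityMeasure_ekHaarSU d N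
  have hc : Continuous fun V : EKConfigSU d N => ekWord l (inclSU V) * (ekWeight N b (inclSU V) : ℂ) :=
    ((continuous_ekWord l).comp continuous_inclSU).mul
      (Complex.continuous_ofReal.comp ((continuous_ekWeight N b).comp continuous_inclSU))
  exact hc.integrable_of_hasCompactSupport
    (IsCompact.of_isClosed_subset isCompact_univ (isClosed_tsupport _) (Set.subset_univ _))

/-- **Exact `ℤ_N` centre symmetry for words**: if the winding `q_μ(l)` is not divisible by `N` (e.g. `q_μ ≠ 0` and the word
is shorter than `N`, `not_dvd_wordCharge`), then `∫ ∏ dV_μ e^{−N² b S_R} W_l = 0` at every `b` — rotate `V_μ ↦ ω_N V_μ`: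
measure and weight are invariant, the word is multiplied by `ω_N^{n₊} ω̄_N^{n₋} ≠ 1`. -/
theorem integral_ekWord_mul_ekWeight_SU (hN : N ≠ 0) (b : ℝ) {l : List (Fin d × Bool)} {μ : Fin d}
    (hq : ¬ ((N : ℤ) ∣ wordCharge l μ)) :
    ∫ V, ekWord l (inclSU V) * (ekWeight N b (inclSU V) : ℂ) ∂ekHaarSU d N = 0 := by
  set c := centerRoot N ^ wordPlus l μ * conj (centerRoot N) ^ wordMinus l μ with hc
  set I := ∫ V, ekWord l (inclSU V) * (ekWeight N b (inclSU V) : ℂ) ∂ekHaarSU d N with hI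
  have key : I = c * I := by
    calc I = ∫ V, ekWord l (inclSU (centerRotateSU μ V)) *
          (ekWeight N b (inclSU (centerRotateSU μ V)) : ℂ) ∂ekHaarSU d N :=
          (integral_comp_leftMulLinkSU μ (centerGenSU N) _).symm
      _ = ∫ V, c * (ekWord l (inclSU V) * (ekWeight N b (inclSU V) : ℂ)) ∂ekHaarSU d N := by
          refine integral_congr_ae (Eventually.of_forall fun V => ?_)
          simp only [ekWord_centerRotateSU, ekWeight_centerRotateSU, hc, mul_assoc]
      _ = c * I := integral_const_mul _ _
  have h1 : (1 - c) * I = 0 := by rw [sub_mul, one_mul, ← key, sub_self]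
  rcases mul_eq_zero.1 h1 with h | h
  · exact absurd (sub_eq_zero.1 h).symm (centerPhase_ne_one hN hq)
  · exact h

/-- Real part: `∫ w · Re W_l = 0` for a word with winding not divisible by `N`. -/
theorem integral_ekWeight_mul_ekWord_re (hN : N ≠ 0) (b : ℝ) {l : List (Fin d × Bool)} {μ : Fin d}
    (hq : ¬ ((N : ℤ) ∣ wordCharge l μ)) :
    ∫ V, ekWeight N b (inclSU V) * (ekWord l (inclSU V)).re ∂ekHaarSU d N = 0 := by
  have h2 := Complex.reCLM.integral_comp_comm (integrable_ekWord_mul_ekWeight_SU (d := d) (N := N) b l)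
  simp only [Complex.reCLM_apply, Complex.re_mul_ofReal] at h2
  rw [integral_ekWord_mul_ekWeight_SU hN b hq, Complex.zero_re] at h2
  rw [← h2]
  exact integral_congr_ae (Eventually.of_forall fun V => mul_comm _ _)

/-- Imaginary part: `∫ w · Im W_l = 0` for a word with winding not divisible by `N`. -/
theorem integral_ekWeight_mul_ekWord_im (hN : N ≠ 0) (b : ℝ) {l : List (Fin d × Bool)} {μ : Fin d}
    (hq : ¬ ((N : ℤ) ∣ wordCharge l μ)) :
    ∫ V, ekWeight N b (inclSU V) * (ekWord l (inclSU V)).im ∂ekHaarSU d N = 0 := by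
  have h2 := Complex.imCLM.integral_comp_comm (integrable_ekWord_mul_ekWeight_SU (d := d) (N := N) b l)
  simp only [Complex.imCLM_apply, Complex.im_mul_ofReal] at h2
  rw [integral_ekWord_mul_ekWeight_SU hN b hq, Complex.zero_im] at h2
  rw [← h2]
  exact integral_congr_ae (Eventually.of_forall fun V => mul_comm _ _)

/-! ## Open words: the second moment is `O(M(l)/N²)` -/

/-- **Second moment of an open word at strong coupling (`SU(N)` model)**: for `16(d−1)|b| < 1`, `N ≥ 1` and a word whose
winding in some direction is not divisible by `N`,
`∫ w |W_l|² ≤ (2 (Σ_μ m_μ²)/N) / (N/2 − 8(d−1)N|b|) · ∫ w`. -/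
theorem integral_ekWeight_mul_normSq_ekWord_le (hN : N ≠ 0) {b : ℝ} (hb : 16 * ((d : ℝ) - 1) * |b| < 1)
    {l : List (Fin d × Bool)} {μ : Fin d} (hq : ¬ ((N : ℤ) ∣ wordCharge l μ)) :
    ∫ V : EKConfigSU d N, ekWeight N b (inclSU V) * ‖ekWord l (inclSU V)‖ ^ 2 ∂(ekHaarSU d N) ≤
      (2 * ((∑ μ : Fin d, (wordMult l μ : ℝ) ^ 2) / N) / ((N : ℝ) / 2 - 8 * ((d : ℝ) - 1) * N * |b|)) *
        ∫ V : EKConfigSU d N, ekWeight N b (inclSU V) ∂(ekHaarSU d N) := by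
  haveI : IsProbabilityMeasure (ekHaarSU d N) := isProbabilityMeasure_ekHaarSU d N
  have hK := ekCurvature_pos (N := N) hN hb (d := d)
  have hre := ek_poincare_wordRe hN hb l
  have him := ek_poincare_wordIm hN hb l
  rw [integral_ekWeight_mul_ekWord_re hN b hq, zero_div] at hre
  rw [integral_ekWeight_mul_ekWord_im hN b hq, zero_div] at him
  simp only [sub_zero] at hre him
  -- continuity / integrability
  have hw : Continuous fun V : EKConfigSU d N => ekWeight N b (inclSU V) := (continuous_ekWeight N b).comp continuous_inclSU
  have hword : Continuous fun V : EKConfigSU d N => ekWord l (inclSU V) := (continuous_ekWord l).comp continuous_inclSU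
  have ire : Integrable (fun V : EKConfigSU d N => ekWeight N b (inclSU V) * (ekWord l (inclSU V)).re ^ 2) (ekHaarSU d N) :=
    (hw.mul ((Complex.continuous_re.comp hword).pow 2)).integrable_of_hasCompactSupport
      (HasCompactSupport.of_compactSpace _)
  have iim : Integrable (fun V : EKConfigSU d N => ekWeight N b (inclSU V) * (ekWord l (inclSU V)).im ^ 2) (ekHaarSU d N) :=
    (hw.mul ((Complex.continuous_im.comp hword).pow 2)).integrable_of_hasCompactSupport
      (HasCompactSupport.of_compactSpace _)
  -- `|W|² = Re² + Im²`
  have hsplit : ∫ V : EKConfigSU d N, ekWeight N b (inclSU V) * ‖ekWord l (inclSU V)‖ ^ 2 ∂(ekHaarSU d N) =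
      ∫ V : EKConfigSU d N, ekWeight N b (inclSU V) * (ekWord l (inclSU V)).re ^ 2 ∂(ekHaarSU d N) +
        ∫ V : EKConfigSU d N, ekWeight N b (inclSU V) * (ekWord l (inclSU V)).im ^ 2 ∂(ekHaarSU d N) := by
    rw [← integral_add ire iim]
    refine integral_congr_ae (Eventually.of_forall fun V => ?_)
    simp only [Complex.sq_norm, Complex.normSq_apply]
    ring
  rw [hsplit]
  set Z := ∫ V : EKConfigSU d N, ekWeight N b (inclSU V) ∂(ekHaarSU d N)
  set M := (∑ μ : Fin d, (wordMult l μ : ℝ) ^ 2) / N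
  set K := (N : ℝ) / 2 - 8 * ((d : ℝ) - 1) * N * |b|
  have hre' : ∫ V : EKConfigSU d N, ekWeight N b (inclSU V) * (ekWord l (inclSU V)).re ^ 2 ∂(ekHaarSU d N) ≤ M / K * Z := by
    rw [div_mul_eq_mul_div, le_div_iff₀ hK, mul_comm]; exact hre
  have him' : ∫ V : EKConfigSU d N, ekWeight N b (inclSU V) * (ekWord l (inclSU V)).im ^ 2 ∂(ekHaarSU d N) ≤ M / K * Z := by
    rw [div_mul_eq_mul_div, le_div_iff₀ hK, mul_comm]; exact him
  calc _ ≤ M / K * Z + M / K * Z := add_le_add hre' him'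
    _ = 2 * M / K * Z := by ring

/-- **`⟨|W_l|²⟩_{SU(N)} ≤ 2 M(l) / (N (N/2 − 8(d−1)N|b|))`** for an open word (winding not divisible by `N`) at strong coupling. -/
theorem ekExpectationSU_normSq_ekWord_le (hN : N ≠ 0) {b : ℝ} (hb : 16 * ((d : ℝ) - 1) * |b| < 1)
    {l : List (Fin d × Bool)} {μ : Fin d} (hq : ¬ ((N : ℤ) ∣ wordCharge l μ)) :
    ekExpectationSU N b (fun V : EKConfigSU d N => ‖ekWord l (inclSU V)‖ ^ 2) ≤
      2 * ((∑ μ : Fin d, (wordMult l μ : ℝ) ^ 2) / N) / ((N : ℝ) / 2 - 8 * ((d : ℝ) - 1) * N * |b|) := by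
  unfold ekExpectationSU
  have hZ := ekPartitionSU_pos d N b
  rw [div_le_iff₀ hZ]
  have h := integral_ekWeight_mul_normSq_ekWord_le hN hb hq
  refine le_trans (le_of_eq ?_) h
  exact integral_congr_ae (Eventually.of_forall fun V => mul_comm _ _)

/-- The second moment is non-negative. -/
theorem ekExpectationSU_normSq_ekWord_nonneg (b : ℝ) (l : List (Fin d × Bool)) :
    0 ≤ ekExpectationSU N b (fun V : EKConfigSU d N => ‖ekWord l (inclSU V)‖ ^ 2) := by
  unfold ekExpectationSU
  refine div_nonneg (integral_nonneg fun V => ?_) (ekPartitionSU_pos d N b).le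
  exact mul_nonneg (by positivity) (Real.exp_pos _).le

/-! ## The `U(N)` model and the large-`N` limit -/

/-- **`U(N)` = `SU(N)` for words**: `⟨|W_l|²⟩_EK` is the same in the `U(N)` and the `SU(N)` single-site models (phase
invariance of `|W_l|²`, w4's transfer `ekExpectation_eq_ekExpectationSU`). -/
theorem ekExpectation_normSq_ekWord_eq (b : ℝ) (l : List (Fin d × Bool)) :
    ekExpectation N b (fun U : EKConfig d N => ‖ekWord l U‖ ^ 2) =
      ekExpectationSU N b (fun V : EKConfigSU d N => ‖ekWord l (inclSU V)‖ ^ 2) :=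
  ekExpectation_eq_ekExpectationSU b _ (measurable_normSq_ekWord l) (isPhaseInvariant_normSq_ekWord l)

/-- **Second moment of an open word in the `U(N)` Eguchi–Kawai model at strong coupling**: for `16(d−1)|b| < 1`, `N ≥ 1`
and a word with winding `q_μ(l)` not divisible by `N`, `⟨|W_l|²⟩_EK ≤ 2 M(l) / (N (N/2 − 8(d−1)N|b|))`, `M(l) = Σ_μ m_μ²`. -/
theorem ekExpectation_normSq_ekWord_le (hN : N ≠ 0) {b : ℝ} (hb : 16 * ((d : ℝ) - 1) * |b| < 1)
    {l : List (Fin d × Bool)} {μ : Fin d} (hq : ¬ ((N : ℤ) ∣ wordCharge l μ)) :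
    ekExpectation N b (fun U : EKConfig d N => ‖ekWord l U‖ ^ 2) ≤
      2 * ((∑ μ : Fin d, (wordMult l μ : ℝ) ^ 2) / N) / ((N : ℝ) / 2 - 8 * ((d : ℝ) - 1) * N * |b|) := by
  rw [ekExpectation_normSq_ekWord_eq]
  exact ekExpectationSU_normSq_ekWord_le hN hb hq

/-- **ALL OPEN WILSON WORDS VANISH AT STRONG COUPLING** (the open-contour hypothesis (14.51) of the Eguchi–Kawai reduction,
`W_EK(C_xy) = 0` for `x ≠ y`, as a theorem at strong coupling): for every `d`, every `b` with `16(d−1)|b| < 1` and every word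
`l` with a non-zero winding `q_μ(l) ≠ 0` in some direction `μ`, `⟨|(1/N) tr U_{μ₁}^{ε₁} ⋯ U_{μ_k}^{ε_k}|²⟩_EK → 0` as `N → ∞`
(indeed `= O(k²/N²)`).  The one-letter case `l = [(μ, +)]` is the `μ`-component of `EKOpenLinesVanish d b` (`ekWord_single`). -/
theorem ekOpenWordsVanish_of_strongCoupling {b : ℝ} (hb : 16 * ((d : ℝ) - 1) * |b| < 1)
    {l : List (Fin d × Bool)} {μ : Fin d} (hq : wordCharge l μ ≠ 0) :
    Tendsto (fun N : ℕ => ekExpectation N b (fun U : EKConfig d N => ‖ekWord l U‖ ^ 2)) atTop (𝓝 0) := by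
  set M := ∑ μ : Fin d, (wordMult l μ : ℝ) ^ 2 with hM
  set κ : ℝ := 1 / 2 - 8 * ((d : ℝ) - 1) * |b| with hκ
  have hκpos : 0 < κ := by rw [hκ]; nlinarith [abs_nonneg b]
  -- the bound `2M/(κ N²)` tends to zero
  have hlim : Tendsto (fun N : ℕ => (2 * M / κ) * ((N : ℝ) ^ 2)⁻¹) atTop (𝓝 0) := by
    have h1 : Tendsto (fun N : ℕ => (N : ℝ) ^ 2) atTop atTop :=
      (tendsto_pow_atTop two_ne_zero).comp tendsto_natCast_atTop_atTop
    simpa using h1.inv_tendsto_atTop.const_mul (2 * M / κ)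
  refine tendsto_of_tendsto_of_tendsto_of_le_of_le' tendsto_const_nhds hlim ?_ ?_
  · exact Eventually.of_forall fun N => by
      rw [ekExpectation_normSq_ekWord_eq]; exact ekExpectationSU_normSq_ekWord_nonneg b l
  · filter_upwards [eventually_gt_atTop l.length] with N hNl
    have hN : N ≠ 0 := by omega
    have hNr : (0 : ℝ) < N := by exact_mod_cast Nat.pos_of_ne_zero hN
    have h := ekExpectation_normSq_ekWord_le hN hb (not_dvd_wordCharge hq hNl)
    refine h.trans (le_of_eq ?_)
    rw [hM, hκ]
    field_simp

/-- The elementary case: for `16(d−1)|b| < 1` the open LINES vanish, `EKOpenLinesVanish d b` — recovered from the word theorem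
with `l = [(μ, +)]` (winding `1`). -/
theorem ekOpenLinesVanish_of_words {b : ℝ} (hb : 16 * ((d : ℝ) - 1) * |b| < 1) :
    Literature.Barriers.QuantumFields.EKOpenLinesVanish d b := by
  intro μ
  have hq : wordCharge [(μ, true)] μ ≠ 0 := by
    simp [wordCharge, wordPlus, wordMinus]
  have h := ekOpenWordsVanish_of_strongCoupling hb hq
  refine h.congr fun N => ?_
  simp only [ekWord_single, Literature.Barriers.QuantumFields.ekOrderParameter]

end Summit.QuantumFields.YangMills.Theorems.EguchiKawaiDirectionLadder
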